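import Mathlib
import Summits.KontsevichZagierPeriods.KontsevichZagierPeriods.Theses.InverseLandau
import Literature.NumberTheory.Transcendental.KZCalculus
import Literature.NumberTheory.Transcendental.EllIterRep
import Summits.KontsevichZagierPeriods.KontsevichZagierPeriods.Theorems.GenusOneIteratedKummerFamily

/-!
# `TateLifting` (stmt-KontsevichZagierPeriods-9129), line `Sketch` — stub `tateLifting_kummerLogTwo`

**Kummer's `log 2` on the lemniscatic curve, inside the Kontsevich–Zagier move calculus.** On
`y² = 4x³ − 4x = 4(x − 1)x(x + 1)` (2-torsion abscissae `e₃ = −1 < e₂ = 0 < e₁ = 1`), every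
two-dimensional integral representation `r` with domain the open triangle
`{−1 < x₀ < x₁ < 0}` and integrand `(x₁ − x₀)/(√(4x₀³ − 4x₀) √(4x₁³ − 4x₁))` on it (the
length-two iterated integral `I(ωη) − I(ηω)` along the upper arc of the real oval) is
`KZ.Equivalent` to every one-dimensional representation `r'` with domain `(1, 2)` and integrand
`1/(2u)` on it (value `½ log 2`). This is verbatim the crux item `KummerLogTwo`
(stmt-KontsevichZagierPeriods-6778) of route GenusOneIterated.

## Proof

Specialisation of the landed general-modulus certificate
`Summit.KontsevichZagierPeriods.GenusOneIterated.KummerFamily.equivalent`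
(`Theorems/GenusOneIteratedKummerFamily.lean`, nine KZ moves: reflection `P ↦ P₁ − P` of the
triangle, Newton–Leibniz with the algebraic primitive `√f/(2(e₁ − x))`, and the affine change of
variables `u = e₁ − x₀`) at the curve `E₀ : KZ.EllCurve` with roots `(e₁, e₂, e₃) = (1, 0, −1)`:
there `E₀.f x = 4(x − 1)(x − 0)(x + 1) = 4x³ − 4x` (`ring`), the triangle
`{e₃ < x₀ < x₁ < e₂}` is `{−1 < x₀ < x₁ < 0}` definitionally, and the target interval
`(e₁ − e₂, e₁ − e₃)` is `(1, 2)` (`norm_num`). No new move is performed.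

Reference: M. Kontsevich, D. Zagier, *Periods* (2001), §1.2.
-/

noncomputable section

namespace Summit.KontsevichZagierPeriods.InverseLandau

open MeasureTheory Set
open Literature.NumberTheory.Transcendental

/-- **Kummer's `log 2` identity on `y² = 4x³ − 4x` as a KZ-equivalence**: a representation
`[{−1 < x₀ < x₁ < 0}, (x₁ − x₀)/(√(4x₀³−4x₀)√(4x₁³−4x₁))]` is `KZ.Equivalent` to a
representation `[(1, 2), 1/(2u)]`. Proof: `GenusOneIterated.KummerFamily.equivalent` at the
lemniscatic curve `(e₁, e₂, e₃) = (1, 0, −1)`. [cite: KontsevichZagier2001, §1.2] -/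
theorem tateLifting_kummerLogTwo :
    ∀ (r : KZ.IntegralRep 2) (r' : KZ.IntegralRep 1),
      r.domain = {x | -1 < x 0 ∧ x 0 < x 1 ∧ x 1 < 0} →
      Set.EqOn r.integrand (fun x => (x 1 - x 0) /
        (Real.sqrt (4 * x 0 ^ 3 - 4 * x 0) * Real.sqrt (4 * x 1 ^ 3 - 4 * x 1))) r.domain →
      r'.domain = {x | 1 < x 0 ∧ x 0 < 2} →
      Set.EqOn r'.integrand (fun x => 1 / (2 * x 0)) r'.domain → KZ.Equivalent r r' := by
  intro r r' hd hi hd' hi'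
  -- the lemniscatic curve `y² = 4(x − 1)(x − 0)(x − (−1))`
  let E₀ : KZ.EllCurve :=
    { e₁ := 1, e₂ := 0, e₃ := -1
      isAlgebraic_e₁ := isAlgebraic_one
      isAlgebraic_e₂ := isAlgebraic_zero
      isAlgebraic_e₃ := isAlgebraic_one.neg
      e₃_lt_e₂ := by norm_num
      e₂_lt_e₁ := by norm_num }
  have hf : ∀ t : ℝ, E₀.f t = 4 * t ^ 3 - 4 * t := fun t => by
    simp only [KZ.EllCurve.f, E₀]
    ring
  refine Summit.KontsevichZagierPeriods.GenusOneIterated.KummerFamily.equivalent E₀ r r' hd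
    (fun x hx => ?_) ?_ hi'
  · simp only [hf]
    exact hi hx
  · rw [hd']
    ext x
    simp only [mem_setOf_eq, E₀]
    norm_num

end Summit.KontsevichZagierPeriods.InverseLandau
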